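import Mathlib
import Summits.MatrixMultiplication.MatrixMultiplication.Theorems.SnSubsetDichotomyPolynomialSlackPolylogPower
import Summits.MatrixMultiplication.MatrixMultiplication.Theorems.SnSubsetDichotomyPolynomialSlackSmallErrors

/-!
# `SnSubsetDichotomy.PolynomialSlack`, line `transport-split-hull` — stub `eventually_sharp_smallA`

Crux `Summit.MatrixMultiplication.MatrixMultiplication.Theses.SnSubsetDichotomy.PolynomialSlack`
(item `stmt-MatrixMultiplication-8306`), level-one programme ("5/8 step"), registered stub
`eventually_sharp_smallA` (E1b) of `Cruxes/PolynomialSlack/Lines/transport-split-hull.lean`;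
pure real analysis.

For a TPP triple with `F = n! √(n!) / N ∈ (0, 8 n ^ C₁]` the induction on `n` runs at the scale
`M := P F² / (n - 1)` with `P := 10³⁴ G¹⁸`, `G := 1 + log n`, `Λ := 1200 G²`.  The one-dense
smallness condition "level-one error + sharp excess `≤ 1 / (7776 Λ² G⁴)`" reads
`F (√6 / √(n (n-1)) + 30 √(6 G² / M) / √(n-1)) + 4 Λ² n M² √M / ((n-1) F) ≤ 1 / (7776 Λ² G⁴)`,
and it holds for all large `n`, uniformly in `F`, exactly when `C₁ < 5/8`.

Proof.  Write `m = n - 1` and `Q = 10¹⁷ G⁹`, so `M = Q² F² / m` and `√M = Q F / √m`.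
* The middle term is *constant in `F`*: `F · 30 √(6 G² / M) / √m = 30 √6 G / Q = 30 √6 / (10¹⁷ G⁸)`,
  far below a third of the right-hand side `1 / (7776 · 1200² · G⁸)`.
* The first term is at most `8 n^{C₁} · 3 / m ≤ 48 n^{C₁ - 1}`; a third of the budget is granted by
  `144 · 7776 · 1200² · G⁸ · n^{C₁} ≤ n` eventually (`C₁ < 1`).
* The last term equals `4 Λ² n Q⁵ F⁴ / (m³ √m)`; with `F⁴ ≤ 4096 n^{4 C₁}` and
  `m³ √m ≥ n³ √n / 16` a third of the budget is granted by `c · G⁵⁷ · n^{4 C₁ + 1} ≤ n^{7/2}`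
  eventually, available precisely because `4 C₁ + 1 < 7/2`, i.e. `C₁ < 5/8`.
Both "eventually" statements are instances of the master comparison
`eventually_log_pow_mul_rpow_le`; the algebra is isolated in `sharpSmallA_pointwise`, where
`G ≥ 1` and `P = n ^ C₁ ≥ 0` are free real parameters (`√x ≤ 2 √(x-1)` is reused from the sibling
file `…SmallErrors`).
-/

namespace Summit.MatrixMultiplication.MatrixMultiplication.Theorems.PolynomialSlack

-- `Summit.<Summit>.<Problem>` is the tree's mandated summit-side namespace; for this
-- single-conjunct summit the two coincide, so the file silences `dupNamespace`.
set_option linter.dupNamespace false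

/-- The square root of the scale: if `M = Q² F² / m` with `m, F, Q > 0` then `√M = Q F / √m`.
[folklore] -/
theorem sharpSmallA_sqrt_scale_eq {m F Q M : ℝ} (hm : 0 < m) (hF : 0 < F) (hQ : 0 < Q)
    (hM : M = Q ^ 2 * F ^ 2 / m) : Real.sqrt M = Q * F / Real.sqrt m := by
  rw [hM, Real.sqrt_div' _ hm.le, show Q ^ 2 * F ^ 2 = (Q * F) ^ 2 by ring,
    Real.sqrt_sq (by positivity)]

/-- The middle term is constant in `F`: with `M = Q² F² / m`,
`F · (30 √(G (6 G) / M) / √m) = 30 √6 G / Q`. [folklore] -/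
theorem sharpSmallA_termB_eq {m G F Q M : ℝ} (hm : 0 < m) (hG : 0 ≤ G) (hF : 0 < F) (hQ : 0 < Q)
    (hM : M = Q ^ 2 * F ^ 2 / m) :
    F * (30 * Real.sqrt (G * (6 * G) / M) / Real.sqrt m) = 30 * Real.sqrt 6 * G / Q := by
  have hs : 0 < Real.sqrt m := Real.sqrt_pos.2 hm
  have hs' : Real.sqrt m ≠ 0 := hs.ne'
  have hF' : F ≠ 0 := hF.ne'
  have hQ' : Q ≠ 0 := hQ.ne'
  have h6G : Real.sqrt (G * (6 * G)) = Real.sqrt 6 * G := by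
    rw [show G * (6 * G) = 6 * G ^ 2 by ring, Real.sqrt_mul (by norm_num), Real.sqrt_sq hG]
  have h0 : 0 ≤ G * (6 * G) := by positivity
  rw [Real.sqrt_div h0, h6G, sharpSmallA_sqrt_scale_eq hm hF hQ hM]
  field_simp

/-- The last term in closed form: with `M = Q² F² / m`,
`4 L x M² √M / (m F) = 4 L x Q⁵ F⁴ / (m³ √m)`. [folklore] -/
theorem sharpSmallA_termC_eq {x m F Q M L : ℝ} (hm : 0 < m) (hF : 0 < F) (hQ : 0 < Q)
    (hM : M = Q ^ 2 * F ^ 2 / m) :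
    4 * L * x * M ^ 2 * Real.sqrt M / (m * F) = 4 * L * x * Q ^ 5 * F ^ 4 / (m ^ 3 * Real.sqrt m) := by
  rw [sharpSmallA_sqrt_scale_eq hm hF hQ hM, hM]
  obtain ⟨s, hs, rfl⟩ : ∃ s : ℝ, 0 < s ∧ m = s ^ 2 :=
    ⟨Real.sqrt m, Real.sqrt_pos.2 hm, (Real.sq_sqrt hm.le).symm⟩
  have hs' : s ≠ 0 := hs.ne'
  have hF' : F ≠ 0 := hF.ne'
  rw [Real.sqrt_sq hs.le]
  field_simp

/-- First term: if `F ≤ 8 P` and `144 · 7776 · 1200² · G⁸ · P ≤ x` with `x ≥ 2`, then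
`F √6 / √(x (x - 1))` is at most a third of `1 / (7776 Λ² G⁴)`, `Λ = 1200 G²`
(`√6 ≤ 3`, `√(x (x-1)) ≥ x - 1 ≥ x / 2`). [folklore] -/
theorem sharpSmallA_termA_le {x G F P : ℝ} (hx : 2 ≤ x) (hG : 1 ≤ G) (hP : 0 ≤ P)
    (hFP : F ≤ 8 * P) (hA : 144 * 7776 * 1200 ^ 2 * G ^ 8 * P ≤ x) :
    F * (Real.sqrt 6 / Real.sqrt (x * (x - 1))) ≤
      1 / (3 * (7776 * (1200 * G ^ 2) ^ 2 * G ^ 4)) := by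
  have hx0 : 0 < x := by linarith
  have hx1 : 0 < x - 1 := by linarith
  have hG0 : 0 < G := by linarith
  have h6 : Real.sqrt 6 ≤ 3 := by  -- adapted from `smallErrors_term₁_le`
    calc Real.sqrt 6 ≤ Real.sqrt (3 ^ 2) := Real.sqrt_le_sqrt (by norm_num)
      _ = 3 := Real.sqrt_sq (by norm_num)
  have hden : x - 1 ≤ Real.sqrt (x * (x - 1)) := by
    calc x - 1 = Real.sqrt ((x - 1) ^ 2) := (Real.sqrt_sq hx1.le).symm
      _ ≤ Real.sqrt (x * (x - 1)) := Real.sqrt_le_sqrt (by nlinarith)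
  have hpos : 0 < Real.sqrt (x * (x - 1)) := Real.sqrt_pos.2 (mul_pos hx0 hx1)
  rw [mul_div_assoc', div_le_div_iff₀ hpos (by positivity)]
  calc F * Real.sqrt 6 * (3 * (7776 * (1200 * G ^ 2) ^ 2 * G ^ 4))
      ≤ 8 * P * 3 * (3 * (7776 * (1200 * G ^ 2) ^ 2 * G ^ 4)) := by gcongr
    _ = 144 * 7776 * 1200 ^ 2 * G ^ 8 * P / 2 := by ring
    _ ≤ x / 2 := by gcongr
    _ ≤ 1 * Real.sqrt (x * (x - 1)) := by linarith

/-- Middle term: for `G ≥ 1`, `F > 0`, `x ≥ 2`, the term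
`F · 30 √(G (6 G) / (10³⁴ G¹⁸ F² / (x-1))) / √(x-1) = 30 √6 / (10¹⁷ G⁸)` is at most a third of
`1 / (7776 Λ² G⁴)`, `Λ = 1200 G²` (a numerical inequality after `√6 ≤ 3`). [folklore] -/
theorem sharpSmallA_termB_le {x G F : ℝ} (hx : 2 ≤ x) (hG : 1 ≤ G) (hF : 0 < F) :
    F * (30 * Real.sqrt (G * (6 * G) / (10 ^ 34 * G ^ 18 * F ^ 2 / (x - 1))) /
        Real.sqrt (x - 1)) ≤
      1 / (3 * (7776 * (1200 * G ^ 2) ^ 2 * G ^ 4)) := by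
  have hx1 : 0 < x - 1 := by linarith
  have hG0 : 0 < G := by linarith
  have hQ : (0 : ℝ) < 10 ^ 17 * G ^ 9 := by positivity
  have hM : 10 ^ 34 * G ^ 18 * F ^ 2 / (x - 1) = (10 ^ 17 * G ^ 9) ^ 2 * F ^ 2 / (x - 1) := by
    ring
  have h6 : Real.sqrt 6 ≤ 3 := by  -- adapted from `smallErrors_term₁_le`
    calc Real.sqrt 6 ≤ Real.sqrt (3 ^ 2) := Real.sqrt_le_sqrt (by norm_num)
      _ = 3 := Real.sqrt_sq (by norm_num)
  rw [sharpSmallA_termB_eq hx1 hG0.le hF hQ hM, div_le_div_iff₀ hQ (by positivity)]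
  calc 30 * Real.sqrt 6 * G * (3 * (7776 * (1200 * G ^ 2) ^ 2 * G ^ 4))
      ≤ 30 * 3 * G * (3 * (7776 * (1200 * G ^ 2) ^ 2 * G ^ 4)) := by gcongr
    _ = (270 * 7776 * 1200 ^ 2) * G ^ 9 := by ring
    _ ≤ 10 ^ 17 * G ^ 9 := mul_le_mul_of_nonneg_right (by norm_num) (by positivity)
    _ = 1 * (10 ^ 17 * G ^ 9) := (one_mul _).symm

/-- Last term (the sharp excess): if `F ≤ 8 P` and
`16 · 12 · 4096 · 7776 · 1200⁴ · 10⁸⁵ · G⁵⁷ · (P⁴ x) ≤ x³ √x` with `x ≥ 2`, `G ≥ 1`, `F > 0`, then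
`4 Λ² x M² √M / ((x-1) F) ≤ (1/3) / (7776 Λ² G⁴)` for `M = 10³⁴ G¹⁸ F² / (x-1)`, `Λ = 1200 G²`
(closed form `4 Λ² x Q⁵ F⁴ / (m³ √m)`, `F⁴ ≤ 4096 P⁴`, `x³ √x ≤ 16 m³ √m`). [folklore] -/
theorem sharpSmallA_termC_le {x G F P : ℝ} (hx : 2 ≤ x) (hG : 1 ≤ G) (hF : 0 < F)
    (hFP : F ≤ 8 * P)
    (hC : 16 * 12 * 4096 * 7776 * 1200 ^ 4 * 10 ^ 85 * G ^ 57 * (P * P * P * P * x) ≤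
      x * x * x * Real.sqrt x) :
    4 * (1200 * G ^ 2) ^ 2 * x * (10 ^ 34 * G ^ 18 * F ^ 2 / (x - 1)) ^ 2 *
          Real.sqrt (10 ^ 34 * G ^ 18 * F ^ 2 / (x - 1)) / ((x - 1) * F) ≤
      1 / (3 * (7776 * (1200 * G ^ 2) ^ 2 * G ^ 4)) := by
  have hx0 : 0 < x := by linarith
  have hx1 : 0 < x - 1 := by linarith
  have hG0 : 0 < G := by linarith
  have hQ : (0 : ℝ) < 10 ^ 17 * G ^ 9 := by positivity
  have hM : 10 ^ 34 * G ^ 18 * F ^ 2 / (x - 1) = (10 ^ 17 * G ^ 9) ^ 2 * F ^ 2 / (x - 1) := by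
    ring
  rw [sharpSmallA_termC_eq hx1 hF hQ hM]
  have hs1 : 0 < Real.sqrt (x - 1) := Real.sqrt_pos.2 hx1
  have hsx : Real.sqrt x ≤ 2 * Real.sqrt (x - 1) := smallErrors_sqrt_le_two_mul_sqrt_sub_one hx
  have hF4 : F ^ 4 ≤ (8 * P) ^ 4 := pow_le_pow_left₀ hF.le hFP 4
  have hx3 : x * x * x ≤ (2 * (x - 1)) ^ 3 := by
    calc x * x * x = x ^ 3 := by ring
      _ ≤ (2 * (x - 1)) ^ 3 := pow_le_pow_left₀ hx0.le (by linarith) 3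
  have hxx : x * x * x * Real.sqrt x ≤ (2 * (x - 1)) ^ 3 * (2 * Real.sqrt (x - 1)) :=
    mul_le_mul hx3 hsx (Real.sqrt_nonneg x) (by positivity)
  rw [div_le_div_iff₀ (by positivity) (by positivity)]
  calc 4 * (1200 * G ^ 2) ^ 2 * x * (10 ^ 17 * G ^ 9) ^ 5 * F ^ 4 *
        (3 * (7776 * (1200 * G ^ 2) ^ 2 * G ^ 4))
      ≤ 4 * (1200 * G ^ 2) ^ 2 * x * (10 ^ 17 * G ^ 9) ^ 5 * (8 * P) ^ 4 *
        (3 * (7776 * (1200 * G ^ 2) ^ 2 * G ^ 4)) := by gcongr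
    _ = 16 * 12 * 4096 * 7776 * 1200 ^ 4 * 10 ^ 85 * G ^ 57 * (P * P * P * P * x) * (1 / 16) := by
        ring
    _ ≤ x * x * x * Real.sqrt x * (1 / 16) := by gcongr
    _ ≤ (2 * (x - 1)) ^ 3 * (2 * Real.sqrt (x - 1)) * (1 / 16) :=
        mul_le_mul_of_nonneg_right hxx (by norm_num)
    _ = 1 * ((x - 1) ^ 3 * Real.sqrt (x - 1)) := by ring

/-- Pointwise assembly with free parameters: for real `x ≥ 2`, `G ≥ 1`, `F > 0`, `P ≥ 0` with
`F ≤ 8 P` and the two polylog-versus-power inequalities (first term, sharp excess), the one-dense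
smallness inequality holds with `G` in place of `1 + log x` and `P` in place of `x ^ C₁`.
[folklore] -/
theorem sharpSmallA_pointwise {x G F P : ℝ} (hx : 2 ≤ x) (hG : 1 ≤ G) (hF : 0 < F) (hP : 0 ≤ P)
    (hFP : F ≤ 8 * P) (hA : 144 * 7776 * 1200 ^ 2 * G ^ 8 * P ≤ x)
    (hC : 16 * 12 * 4096 * 7776 * 1200 ^ 4 * 10 ^ 85 * G ^ 57 * (P * P * P * P * x) ≤
      x * x * x * Real.sqrt x) :
    F * (Real.sqrt 6 / Real.sqrt (x * (x - 1)) +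
          30 * Real.sqrt (G * (6 * G) / (10 ^ 34 * G ^ 18 * F ^ 2 / (x - 1))) /
            Real.sqrt (x - 1)) +
        4 * (1200 * G ^ 2) ^ 2 * x * (10 ^ 34 * G ^ 18 * F ^ 2 / (x - 1)) ^ 2 *
            Real.sqrt (10 ^ 34 * G ^ 18 * F ^ 2 / (x - 1)) / ((x - 1) * F) ≤
      1 / (7776 * (1200 * G ^ 2) ^ 2 * G ^ 4) := by
  have eA := sharpSmallA_termA_le hx hG hP hFP hA
  have eB := sharpSmallA_termB_le hx hG hF
  have eC := sharpSmallA_termC_le hx hG hF hFP hC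
  have hr : ∀ r : ℝ, 1 / (3 * r) + 1 / (3 * r) + 1 / (3 * r) = 1 / r := by
    intro r
    ring
  rw [mul_add]
  exact (add_le_add (add_le_add eA eB) eC).trans_eq (hr _)

/-- Real-variable assembly: from the two instances of the master polylog-versus-power comparison
(in the raw `Real.rpow` form in which `eventually_log_pow_mul_rpow_le` delivers them) at a real
`x ≥ 2` and any `F ∈ (0, 8 x ^ C₁]`, the one-dense smallness inequality follows
(`sharpSmallA_pointwise` with `G := 1 + log x`, `P := x ^ C₁`). [folklore] -/
theorem sharpSmallA_of_master {x C₁ F : ℝ} (hx : 2 ≤ x) (hF : 0 < F) (hFle : F ≤ 8 * x ^ C₁)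
    (h1 : 144 * 7776 * 1200 ^ 2 * (1 + Real.log x) ^ 8 * x ^ C₁ ≤ x ^ (1 : ℝ))
    (h2 : 16 * 12 * 4096 * 7776 * 1200 ^ 4 * 10 ^ 85 * (1 + Real.log x) ^ 57 *
        x ^ (C₁ + C₁ + C₁ + C₁ + 1) ≤ x ^ (1 + 1 + 1 + 1 / 2 : ℝ)) :
    F * (Real.sqrt 6 / Real.sqrt (x * (x - 1)) +
          30 * Real.sqrt ((1 + Real.log x) * (6 * (1 + Real.log x)) /
            (10 ^ 34 * (1 + Real.log x) ^ 18 * F ^ 2 / (x - 1))) / Real.sqrt (x - 1)) +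
        4 * (1200 * (1 + Real.log x) ^ 2) ^ 2 * x *
          (10 ^ 34 * (1 + Real.log x) ^ 18 * F ^ 2 / (x - 1)) ^ 2 *
            Real.sqrt (10 ^ 34 * (1 + Real.log x) ^ 18 * F ^ 2 / (x - 1)) /
          ((x - 1) * F) ≤
      1 / (7776 * (1200 * (1 + Real.log x) ^ 2) ^ 2 * (1 + Real.log x) ^ 4) := by
  have hx0 : 0 < x := by linarith
  have hG : 1 ≤ 1 + Real.log x := by
    have := Real.log_nonneg (by linarith : (1 : ℝ) ≤ x)
    linarith
  have hP : 0 ≤ x ^ C₁ := Real.rpow_nonneg hx0.le C₁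
  rw [Real.rpow_one] at h1
  simp only [Real.rpow_add hx0, Real.rpow_one] at h2
  rw [← Real.sqrt_eq_rpow] at h2
  exact sharpSmallA_pointwise hx hG hF hP hFle h1 h2

/-- **One-dense smallness, eventually** (registered stub `eventually_sharp_smallA`, E1b, of line
`transport-split-hull`): for `C₁ < 5/8` there is `n₀` such that for all `n ≥ n₀` and every
`F ∈ (0, 8 n ^ C₁]`, with `G = 1 + log n`, `Λ = 1200 G²` and `M = 10³⁴ G¹⁸ F² / (n - 1)`,
`F (√6 / √(n (n-1)) + 30 √(G · 6 G / M) / √(n-1)) + 4 Λ² n M² √M / ((n-1) F) ≤ 1 / (7776 Λ² G⁴)`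
(two instances of `eventually_log_pow_mul_rpow_le`, the second with exponents
`4 C₁ + 1 < 7/2`, assembled by `sharpSmallA_of_master`). [folklore] -/
theorem eventually_sharp_smallA (C₁ : ℝ) (hC₁ : C₁ < 5 / 8) :
    ∃ n₀ : ℕ, ∀ n : ℕ, n₀ ≤ n → ∀ F : ℝ, 0 < F → F ≤ 8 * (n : ℝ) ^ C₁ →
      F * (Real.sqrt 6 / Real.sqrt ((n : ℝ) * ((n : ℝ) - 1)) +
            30 * Real.sqrt ((1 + Real.log n) * (6 * (1 + Real.log n)) /
              (10 ^ 34 * (1 + Real.log n) ^ 18 * F ^ 2 / ((n : ℝ) - 1))) / Real.sqrt ((n : ℝ) - 1)) +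
          4 * (1200 * (1 + Real.log n) ^ 2) ^ 2 * n *
            (10 ^ 34 * (1 + Real.log n) ^ 18 * F ^ 2 / ((n : ℝ) - 1)) ^ 2 *
              Real.sqrt (10 ^ 34 * (1 + Real.log n) ^ 18 * F ^ 2 / ((n : ℝ) - 1)) /
            (((n : ℝ) - 1) * F) ≤
        1 / (7776 * (1200 * (1 + Real.log n) ^ 2) ^ 2 * (1 + Real.log n) ^ 4) := by
  obtain ⟨N₁, hN₁⟩ :=
    eventually_log_pow_mul_rpow_le 8 C₁ 1 (144 * 7776 * 1200 ^ 2) (by linarith) (by norm_num)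
  obtain ⟨N₂, hN₂⟩ :=
    eventually_log_pow_mul_rpow_le 57 (C₁ + C₁ + C₁ + C₁ + 1) (1 + 1 + 1 + 1 / 2)
      (16 * 12 * 4096 * 7776 * 1200 ^ 4 * 10 ^ 85) (by linarith) (by norm_num)
  refine ⟨max 2 (max N₁ N₂), fun n hn F hF hFle => ?_⟩
  simp only [max_le_iff] at hn
  obtain ⟨h2, hn1, hn2⟩ := hn
  have hx : (2 : ℝ) ≤ n := by exact_mod_cast h2
  exact sharpSmallA_of_master hx hF hFle (hN₁ n hn1) (hN₂ n hn2)

end Summit.MatrixMultiplication.MatrixMultiplication.Theorems.PolynomialSlack
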